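import Literature.Topology.Euclidean.BrouwerFixedPoint
import Mathlib.Analysis.InnerProductSpace.EuclideanDist
import HarnessLib

/-!
# Brouwer's fixed point theorem for closed balls of finite-dimensional normed spaces

Topic `Literature/Topology/Euclidean` (namespace `Literature.Topology.Euclidean.Brouwer`).
Everything in this file is PROVED; there are no definitions and no named facts.

The tree's `Literature.Topology.Euclidean.Brouwer.exists_fixedPoint_closedBall` is Brouwer's
theorem for the closed UNIT ball of a finite-dimensional real INNER PRODUCT space. Here it is
transported to the closed ball `closedBall c R` (`R ≥ 0`) of an arbitrary finite-dimensional real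
normed space `F` (e.g. `ι → ℂ` with the sup norm, whose closed unit ball is the polydisc
`{z : |z_i| ≤ 1}` — the set `D` of Booker–Thorne 2014, Prop. 9, and the domains of the Brouwer
arguments in their Props. 8–9): `exists_fixedPoint_closedBall_of_finiteDimensional`. Proof: a
continuous linear homeomorphism `T : F ≃L[ℝ] ℝᵈ` onto a Euclidean space (Mathlib `toEuclidean`),
the continuous retraction `r` of `F` onto `closedBall c R`, a Euclidean ball `closedBall 0 ρ`
containing `T(closedBall c R)`, and Brouwer for the self-map `y ↦ T(f(r(T⁻¹ y)))` of that ball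
(rescaled to the unit ball): a fixed point `y` gives `x = r(T⁻¹ y)` with `f x = T⁻¹ y`, so
`r (f x) = x`, and since `f x` lies in the ball, `f x = x`. (Tao, *Hilbert's Fifth Problem and
Related Topics*, remark after Thm. 6.2.1: the theorem "is a topological statement" and holds for
any compact convex body; Deo, *Algebraic Topology*, Cor. 4.7.4.)

## References

* [Tao2014] T. Tao, *Hilbert's Fifth Problem and Related Topics*, GSM 153 (2014), Thm. 6.2.1 and
  the remark following it.
* [BookerThorne2014] A. R. Booker, F. Thorne, Algebra Number Theory 8 (2014), Props. 8–9 (the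
  Brouwer arguments on polydiscs `(C + R')D`, `B^n`).
-/

noncomputable section

open Metric Set Filter Topology

namespace Literature.Topology.Euclidean.Brouwer

/-- Brouwer's fixed point theorem for the closed ball of radius `ρ > 0` about `0` in a
finite-dimensional real inner product space (rescaling of `exists_fixedPoint_closedBall`).
[cite: Tao2014, Thm. 6.2.1] -/
theorem exists_fixedPoint_closedBall_radius {E : Type*} [NormedAddCommGroup E]
    [InnerProductSpace ℝ E] [FiniteDimensional ℝ E] {ρ : ℝ} (hρ : 0 < ρ) {f : E → E}
    (hf : ContinuousOn f (closedBall (0 : E) ρ))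
    (hfB : MapsTo f (closedBall (0 : E) ρ) (closedBall (0 : E) ρ)) :
    ∃ x ∈ closedBall (0 : E) ρ, f x = x := by
  -- conjugate by the dilation `u ↦ ρ • u`
  set h : E → E := fun u ↦ ρ⁻¹ • f (ρ • u) with hh
  have hmem : ∀ u ∈ closedBall (0 : E) 1, ρ • u ∈ closedBall (0 : E) ρ := by
    intro u hu
    rw [mem_closedBall_zero_iff] at hu ⊢
    rw [norm_smul, Real.norm_of_nonneg hρ.le]
    nlinarith
  have hcont : ContinuousOn h (closedBall (0 : E) 1) := by
    refine ContinuousOn.const_smul (hf.comp (continuous_const_smul ρ).continuousOn hmem) _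
  have hmaps : MapsTo h (closedBall (0 : E) 1) (closedBall (0 : E) 1) := by
    intro u hu
    have h1 := hfB (hmem u hu)
    rw [mem_closedBall_zero_iff] at h1 ⊢
    simp only [hh]
    rw [norm_smul, norm_inv, Real.norm_of_nonneg hρ.le]
    rw [inv_mul_le_iff₀ hρ, mul_one]
    exact h1
  obtain ⟨u, hu, hfix⟩ := exists_fixedPoint_closedBall hcont hmaps
  refine ⟨ρ • u, hmem u hu, ?_⟩
  have : ρ • (ρ⁻¹ • f (ρ • u)) = ρ • u := by rw [show ρ⁻¹ • f (ρ • u) = u from hfix]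
  rwa [smul_smul, mul_inv_cancel₀ hρ.ne', one_smul] at this

/-- **Brouwer's fixed point theorem for closed balls of finite-dimensional normed spaces.** Let
`F` be a finite-dimensional real normed space, `c ∈ F`, `R ≥ 0`, and `f : F → F` continuous on
`closedBall c R` with `f(closedBall c R) ⊆ closedBall c R`. Then `f` has a fixed point in
`closedBall c R`. (For `F = ι → ℂ` with the sup norm the ball is the polydisc
`{z : ‖z_i − c_i‖ ≤ R}`.) [cite: Tao2014, Thm. 6.2.1 and the remark following it] -/
theorem exists_fixedPoint_closedBall_of_finiteDimensional {F : Type*} [NormedAddCommGroup F]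
    [NormedSpace ℝ F] [FiniteDimensional ℝ F] {c : F} {R : ℝ} (hR : 0 ≤ R) {f : F → F}
    (hf : ContinuousOn f (closedBall c R)) (hfB : MapsTo f (closedBall c R) (closedBall c R)) :
    ∃ x ∈ closedBall c R, f x = x := by
  rcases hR.eq_or_lt with hR0 | hRpos
  · -- the ball is the point `c`
    refine ⟨c, mem_closedBall_self hR, ?_⟩
    have := hfB (mem_closedBall_self hR)
    rw [← hR0, closedBall_zero, mem_singleton_iff] at this
    exact this
  -- the retraction onto the ball
  set r : F → F := fun x ↦ c + (R / max R ‖x - c‖) • (x - c) with hr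
  have hmaxpos : ∀ x : F, 0 < max R ‖x - c‖ := fun x ↦ lt_of_lt_of_le hRpos (le_max_left _ _)
  have hrcont : Continuous r := by
    refine continuous_const.add (Continuous.smul ?_ (continuous_id.sub continuous_const))
    exact continuous_const.div (continuous_const.max (continuous_id.sub continuous_const).norm)
      fun x ↦ (hmaxpos x).ne'
  have hrB : ∀ x, r x ∈ closedBall c R := by
    intro x
    rw [mem_closedBall, dist_eq_norm, hr]
    dsimp only
    rw [add_sub_cancel_left, norm_smul, norm_div, Real.norm_of_nonneg hR,
      Real.norm_of_nonneg (hmaxpos x).le]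
    rw [div_mul_eq_mul_div, div_le_iff₀ (hmaxpos x)]
    exact mul_le_mul_of_nonneg_left (le_max_right _ _) hR
  have hrid : ∀ x ∈ closedBall c R, r x = x := by
    intro x hx
    rw [mem_closedBall, dist_eq_norm] at hx
    rw [hr]
    dsimp only
    rw [max_eq_left hx, div_self hRpos.ne', one_smul, add_sub_cancel]
  -- transport to a Euclidean space
  set T := toEuclidean (E := F) with hT
  set E' := EuclideanSpace ℝ (Fin (Module.finrank ℝ F))
  set ρ : ℝ := ‖(T : F →L[ℝ] E')‖ * (‖c‖ + R) + 1 with hρdef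
  have hρ : 0 < ρ := by positivity
  have hTball : ∀ x ∈ closedBall c R, T x ∈ closedBall (0 : E') ρ := by
    intro x hx
    rw [mem_closedBall, dist_eq_norm] at hx
    rw [mem_closedBall_zero_iff]
    have hx' : ‖x‖ ≤ ‖c‖ + R := by
      have := norm_le_norm_add_norm_sub' x c
      have h2 : ‖x - c‖ ≤ R := hx
      linarith [norm_sub_rev x c]
    calc ‖T x‖ = ‖(T : F →L[ℝ] E') x‖ := rfl
      _ ≤ ‖(T : F →L[ℝ] E')‖ * ‖x‖ := ContinuousLinearMap.le_opNorm _ _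
      _ ≤ ‖(T : F →L[ℝ] E')‖ * (‖c‖ + R) := mul_le_mul_of_nonneg_left hx' (norm_nonneg _)
      _ ≤ ρ := by rw [hρdef]; linarith
  -- the conjugated self-map of the Euclidean ball
  set g : E' → E' := fun y ↦ T (f (r (T.symm y))) with hg
  have hgcont : Continuous g := by
    have h1 : Continuous fun y : E' ↦ r (T.symm y) := hrcont.comp T.symm.continuous
    have h2 : Continuous fun y : E' ↦ f (r (T.symm y)) :=
      hf.comp_continuous h1 fun y ↦ hrB _
    exact T.continuous.comp h2
  have hgmaps : MapsTo g (closedBall (0 : E') ρ) (closedBall (0 : E') ρ) :=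
    fun y _ ↦ hTball _ (hfB (hrB _))
  obtain ⟨y, -, hy⟩ := exists_fixedPoint_closedBall_radius hρ hgcont.continuousOn hgmaps
  -- read off the fixed point of `f`
  set x : F := r (T.symm y) with hxdef
  have hx : x ∈ closedBall c R := hrB _
  have hfx : f x = T.symm y := by
    have : T (f x) = y := hy
    rw [← this, ContinuousLinearEquiv.symm_apply_apply]
  refine ⟨x, hx, ?_⟩
  have h1 : r (f x) = x := by rw [hfx]
  rw [hrid (f x) (hfB hx)] at h1
  exact h1

end Literature.Topology.Euclidean.Brouwer
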